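import Mathlib
import HarnessLib
import Literature.MathematicalPhysics.QuantumLattice.HubbardSpaceTimeCharacters
import Summits.HubbardSuperconductivity.HubbardSuperconductivity.Theorems.KLProgrammeKLRegimeSplitPredicates
import Summits.HubbardSuperconductivity.HubbardSuperconductivity.Theorems.KLProgrammeKLRegimeTorusL1DyadicSuperposition

/-!
# Route `KLProgramme` — engine support (row (X).1 / located risk #14 «S3 IN U-CURRENCY», NORM side, brick (T2)): the PLAIN four-leg pinned
# `L¹` line of a quartic position kernel handed as a superposition of PAIR-TRANSFER BUMPS is paid by the `ℓ¹` sum of the amplitudes — so a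
# total-variation-across-scales law on the VALUE side is a `U`-currency law for the plain line, modulo the representation

Cell `gate-hubbard-kl`, seat hubbard-kl-k3c2-p3 (g16; row «sector-counting import (DR2000 L11/L12) for the leg-dress bar»), ENGINE crux
stmt-HubbardSuperconductivity-20437 (`KLRegimeEngineV17F2`), row (X).1 / #14, pen g25 (R366)(iv) «(X).1-CURRENCY-BRICK», (R368)(C), (R386)(B) (GO).
The object is the plain four-leg pinned line of the (ℓ)/(b)-WT4 import rows
(`EngineV8.importRowsF_of_plainLines_klEng`: `fixedTupleL1 L M β 3 (sectorisedKernel … trivialMultiplier 𝒱 4) ((0,s),c') y₀ ≤ s₄·lam`).  Its VALUE-side input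
is in the tree (child 1, `KLRegimeSplit.quarticValueVariation_of_edgeClauses_explicit`: `Σ_{i<n} ‖λ_{i+1}^{↑↓}[K_{i+1}](k) − λ_i^{↑↓}[K_i](k)‖ ≤ (11/9)U + C·U²`
at pinned momenta).  This file is the NORM-side conversion, with the representation stated as HYPOTHESES (the E1-class structural inputs
(s1) «freezing / single-scale regularity in the transfer», (s2) «sup read at the pin», (s3) «kernel ↔ value representation», pen (R386)(B)) and nothing claimed:

* §1 `sum_tuple_succ`, **`fixedTupleL1_le_of_superposition`** — the fixed-tuple size of `W = Σ_{i∈S} a_i·B_i + R` is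
  `≤ Σ_i ‖a_i‖·fixedTupleL1(B_i) + fixedTupleL1(R)` (any leg count, any family);
* §2 **`fixedTupleL1_le_of_pairTransfer`** — a four-leg kernel MAJORISED BY A PAIR-TRANSFER FORM, `‖B Ω x‖ ≤ [x₁ = x₀][x₃ = x₂]·c·‖Σ_q χ_q(x₀ − x₂)•G(q)‖`
  (legs `0,1` at one space-time point, legs `2,3` at another, a product-torus character sum of the symbol `G` in the difference; the two other
  pairings of leg `0` in `fixedTupleL1_le_of_pairTransfer'`/`''`), has `fixedTupleL1 L M β 3 B Ω x₁ ≤ ε_x³·c·Σ_z ‖Σ_q χ_q(z)•G(q)‖`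
  (`HubbardSpaceTimeCharacters.sum_spaceTime_eq_sum_prodTorus`);
* §3 **`fixedTupleL1_le_of_pairTransfer_bump`** — if moreover `G` is a BUMP of rates `(s₀,s₁) ∈ (0,1]²` (support `≤ n₀(s₀·2M)(s₁L)²`, sup `≤ A`,
  axis second differences `≤ A(4/(s₀·2M))²`, `A(4/(s₁L))²`), then `fixedTupleL1 … ≤ ε_x³·c·√(10485760·n₀)·(2M·L²)·A`
  (`TorusFourierL2.sum_norm_charSum_bump_le`, brick (T1)) — scale-free;
* §4 **`fixedTupleL1_le_of_pairTransfer_superposition`** — assembled: `W Ω = Σ_{i∈S} a_i·B_i + R` with pair-transfer bumps `B_i` (rates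
  `(s₀ⁱ,s₁ⁱ)`, sizes `A_i`, common normalisation `c`) ⟹ `fixedTupleL1(W) ≤ ε_x³·c·√(10485760·n₀)·(2M·L²)·Σ_i ‖a_i‖A_i + fixedTupleL1(R)`;
  **`plainFourLegLine_of_pairTransfer_superposition`** — the import-row shape: if for EVERY label tuple `((0,s),c')` the quartic position kernel
  `sectorisedKernel L M β trivialMultiplier 𝒱 4` is so represented with `Σ_i ‖a_i‖·A_i ≤ V` and `fixedTupleL1(R) ≤ r`, and
  `ε_x³·c·(2M·L²) ≤ κ`, then `∀ s c' y₀, fixedTupleL1 L M β 3 (sectorisedKernel … 𝒱 4) ((0,s),c') y₀ ≤ κ·√(10485760·n₀)·V + r` — with the model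
  normalisation `c = (2M·L²)²/(4!·(βL²)³)` of a conserving quartic, `κ = 1/24`.

Reading for #14: with `S = range n`, `a_i = λ_{i+1}^{↑↓}[K_{i+1}](k⋆) − λ_i^{↑↓}[K_i](k⋆)` at the pinned momenta and `A_i = 1` (hypotheses (s1)–(s3): the scale-`i`
increment of the quartic IS such an amplitude times a transfer bump at scale `Λ_i`, up to a remainder of plain line `r_i`), row 7 gives
`V = (11/9)U + C·U²`, i.e. the plain line is `U`-CURRENCY uniformly in `n` — whereas paying each scale by its sup gives `Σ_i sup = U + C·U²·n`
(`epsCoupling`, BGM (3.65)).  Everything is proved; no definitions, no named facts; nothing here asserts the representation for the model, (X).1,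
a branch, K3 or superconductivity. [folklore]

References: G. Benfatto, A. Giuliani, V. Mastropietro, Ann. Henri Poincaré 7 (2006) 809–898, §2.3 (2.17), §2.7 (2.70)–(2.71), §3 (3.65);
HOME/hubbard-kl-k3c2-p3/X-CURRENCY-IMPORTSIDE.md (★), P2-IMPORT.md §2bis.
-/

noncomputable section

namespace Summit.HubbardSuperconductivity.HubbardSuperconductivity.Theorems.TorusFourierL2

set_option linter.dupNamespace false -- summit = problem name (single-conjunct summit), D-0017

open Finset Complex Literature.Probability.LatticeModels Literature.MathematicalPhysics.QuantumLattice
open Summit.HubbardSuperconductivity.HubbardSuperconductivity.Theorems.KLRegimeSplit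
open scoped Real

variable {L M : ℕ} [NeZero L] [NeZero M]

/-! ### §1 Superpositions inside the fixed-tuple size -/

omit [NeZero L] [NeZero M] in
/-- A sum over `(n+1)`-tuples is the double sum over the head and the tail. [folklore] -/
theorem sum_tuple_succ {Γ E : Type*} [Fintype Γ] [AddCommMonoid E] {n : ℕ} (f : (Fin (n + 1) → Γ) → E) :
    ∑ U, f U = ∑ X : Γ, ∑ W : Fin n → Γ, f (Fin.cons X W) := by
  rw [← Fintype.sum_prod_type']
  exact (Fintype.sum_equiv (Fin.consEquiv fun _ => Γ) _ _ fun _ => rfl).symm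

omit [NeZero L] [NeZero M] in
/-- A sum over `1`-tuples is a sum over the entry. [folklore] -/
theorem sum_tuple_one {Γ E : Type*} [Fintype Γ] [AddCommMonoid E] (F : (Fin 1 → Γ) → E) :
    ∑ W, F W = ∑ w : Γ, F (fun _ => w) := by
  refine Fintype.sum_equiv (Equiv.funUnique (Fin 1) Γ) F (fun w => F (fun _ => w)) fun W => ?_
  show F W = F (fun _ => W default)
  congr 1
  funext i
  exact congrArg W (Subsingleton.elim i default)

omit [NeZero L] [NeZero M] in
/-- `Σ_X [X = y ∧ Q]·v = [Q]·v`. [folklore] -/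
theorem sum_ite_eq_and {Γ E : Type*} [Fintype Γ] [DecidableEq Γ] [AddCommMonoid E] (y : Γ) (Q : Prop) [Decidable Q] (v : E) :
    ∑ X : Γ, (if X = y ∧ Q then v else 0) = if Q then v else 0 := by
  rw [Finset.sum_eq_single y]
  · simp
  · intro X _ hX; simp [hX]
  · intro h; exact absurd (Finset.mem_univ y) h

omit [NeZero L] [NeZero M] in
/-- **The pair-forced triple sum**: `Σ_{x : Fin 3 → Γ} [x₀ = y][x₂ = x₁]·g(x₁) = Σ_w g(w)`. [folklore] -/
theorem sum_pairForced {Γ E : Type*} [Fintype Γ] [DecidableEq Γ] [AddCommMonoid E] (g : Γ → E) (y : Γ) :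
    ∑ x : Fin 3 → Γ, (if x 0 = y ∧ x 2 = x 1 then g (x 1) else 0) = ∑ w, g w := by
  rw [sum_tuple_succ]
  have hc : ∀ (X : Γ) (W : Fin 2 → Γ), (if (Fin.cons X W : Fin 3 → Γ) 0 = y ∧ (Fin.cons X W : Fin 3 → Γ) 2 = (Fin.cons X W : Fin 3 → Γ) 1
      then g ((Fin.cons X W : Fin 3 → Γ) 1) else 0) = (if X = y ∧ W 1 = W 0 then g (W 0) else 0) := fun X W => rfl
  rw [sum_congr rfl fun X _ => sum_congr rfl fun W _ => hc X W, Finset.sum_comm]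
  simp_rw [sum_ite_eq_and]
  rw [sum_tuple_succ]
  have hc2 : ∀ (a : Γ) (W : Fin 1 → Γ), (if (Fin.cons a W : Fin 2 → Γ) 1 = (Fin.cons a W : Fin 2 → Γ) 0
      then g ((Fin.cons a W : Fin 2 → Γ) 0) else 0) = (if W 0 = a then g a else 0) := fun a W => rfl
  rw [sum_congr rfl fun a _ => sum_congr rfl fun W _ => hc2 a W]
  refine sum_congr rfl fun a _ => ?_
  rw [sum_tuple_one]
  show ∑ w : Γ, (if w = a then g a else 0) = g a
  rw [Finset.sum_eq_single a]
  · simp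
  · intro w _ hw; simp [hw]
  · intro h; exact absurd (Finset.mem_univ a) h

omit [NeZero M] in
/-- **The fixed-tuple size of a superposition**: if `W Ω x = Σ_{i∈S} a_i·B_i Ω x + R Ω x` for all `x`, then
`fixedTupleL1(W) Ω x₁ ≤ Σ_i ‖a_i‖·fixedTupleL1(B_i) Ω x₁ + fixedTupleL1(R) Ω x₁`. [folklore] -/
theorem fixedTupleL1_le_of_superposition {ι : Type*} {N m : ℕ} {β : ℝ} (hβ : 0 ≤ β) (S : Finset ι) (a : ι → ℂ)
    (W R : (Fin (m + 1) → SectorLeg N) → (Fin (m + 1) → SpaceTimeIdx L M) → ℂ)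
    (B : ι → (Fin (m + 1) → SectorLeg N) → (Fin (m + 1) → SpaceTimeIdx L M) → ℂ)
    (Ω : Fin (m + 1) → SectorLeg N) (hW : ∀ x, W Ω x = ∑ i ∈ S, a i * B i Ω x + R Ω x) (x₁ : SpaceTimeIdx L M) :
    fixedTupleL1 L M β m W Ω x₁ ≤ ∑ i ∈ S, ‖a i‖ * fixedTupleL1 L M β m (B i) Ω x₁ + fixedTupleL1 L M β m R Ω x₁ := by
  have hε : 0 ≤ imagTimeWeight β M ^ m := pow_nonneg (imagTimeWeight_nonneg hβ M) m
  unfold fixedTupleL1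
  have hpt : ∀ x : Fin m → SpaceTimeIdx L M, ‖W Ω (Matrix.vecCons x₁ x)‖ ≤
      ∑ i ∈ S, ‖a i‖ * ‖B i Ω (Matrix.vecCons x₁ x)‖ + ‖R Ω (Matrix.vecCons x₁ x)‖ := by
    intro x
    rw [hW]
    refine (norm_add_le _ _).trans (add_le_add ((norm_sum_le _ _).trans (le_of_eq ?_)) le_rfl)
    exact sum_congr rfl fun i _ => norm_mul _ _
  calc imagTimeWeight β M ^ m * ∑ x : Fin m → SpaceTimeIdx L M, ‖W Ω (Matrix.vecCons x₁ x)‖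
      ≤ imagTimeWeight β M ^ m * ∑ x : Fin m → SpaceTimeIdx L M,
          (∑ i ∈ S, ‖a i‖ * ‖B i Ω (Matrix.vecCons x₁ x)‖ + ‖R Ω (Matrix.vecCons x₁ x)‖) :=
        mul_le_mul_of_nonneg_left (sum_le_sum fun x _ => hpt x) hε
    _ = _ := by
        rw [sum_add_distrib, mul_add, sum_comm, mul_sum]
        congr 1
        refine sum_congr rfl fun i _ => ?_
        rw [← mul_sum]
        ring

/-! ### §2 Pair-transfer forms: legs `0,1` at one point, legs `2,3` at another, a character sum in the difference -/

/-- **The fixed-tuple size of a kernel majorised by a pair-transfer form (pairing `{0,1}{2,3}`)**: if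
`‖B Ω x‖ ≤ [x₁ = x₀][x₃ = x₂]·c·‖Σ_q χ_{q₁}((x₀)₀ − (x₂)₀)χ_{q₂}(x⃗₀ − x⃗₂)•G(q)‖`, then `fixedTupleL1 L M β 3 B Ω y ≤ ε_x³·c·Σ_z‖Σ_q χ_q(z)•G(q)‖`.
[cite: BenfattoGiulianiMastropietro2006, §2.3 (2.17)] -/
theorem fixedTupleL1_le_of_pairTransfer {N : ℕ} {β : ℝ} (hβ : 0 ≤ β) (B : (Fin 4 → SectorLeg N) → (Fin 4 → SpaceTimeIdx L M) → ℂ)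
    (Ω : Fin 4 → SectorLeg N) (G : TorusSite 1 (2 * M) × TorusSite 2 L → ℂ) {c : ℝ}
    (hB : ∀ x : Fin 4 → SpaceTimeIdx L M, ‖B Ω x‖ ≤
      if x 1 = x 0 ∧ x 3 = x 2 then c * ‖∑ q : TorusSite 1 (2 * M) × TorusSite 2 L,
        (torusChar q.1 (fun _ : Fin 1 => (((x 0).1 : ℕ) : ZMod (2 * M)) - (((x 2).1 : ℕ) : ZMod (2 * M))) *
          torusChar q.2 ((x 0).2 - (x 2).2)) • G q‖ else 0) (y : SpaceTimeIdx L M) :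
    fixedTupleL1 L M β 3 B Ω y ≤ imagTimeWeight β M ^ 3 * (c *
      ∑ z : TorusSite 1 (2 * M) × TorusSite 2 L, ‖∑ q : TorusSite 1 (2 * M) × TorusSite 2 L, (torusChar q.1 z.1 * torusChar q.2 z.2) • G q‖) := by
  classical
  set CS : TorusSite 1 (2 * M) × TorusSite 2 L → ℝ := fun z =>
    ‖∑ q : TorusSite 1 (2 * M) × TorusSite 2 L, (torusChar q.1 z.1 * torusChar q.2 z.2) • G q‖ with hCS
  set D : SpaceTimeIdx L M → SpaceTimeIdx L M → TorusSite 1 (2 * M) × TorusSite 2 L := fun u v =>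
    ((fun _ : Fin 1 => ((u.1 : ℕ) : ZMod (2 * M)) - ((v.1 : ℕ) : ZMod (2 * M))), u.2 - v.2) with hD
  have hB' : ∀ x : Fin 4 → SpaceTimeIdx L M, ‖B Ω x‖ ≤ if x 1 = x 0 ∧ x 3 = x 2 then c * CS (D (x 0) (x 2)) else 0 := by
    intro x; simpa [hCS, hD] using hB x
  unfold fixedTupleL1
  refine mul_le_mul_of_nonneg_left ?_ (pow_nonneg (imagTimeWeight_nonneg hβ M) 3)
  -- majorise termwise, then evaluate the sum of the pair-transfer majorant
  have hmaj : ∑ x : Fin 3 → SpaceTimeIdx L M, ‖B Ω (Matrix.vecCons y x)‖ ≤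
      ∑ x : Fin 3 → SpaceTimeIdx L M, (if x 0 = y ∧ x 2 = x 1 then c * CS (D y (x 1)) else 0) := by
    refine sum_le_sum fun x _ => (hB' _).trans (le_of_eq ?_)
    simp only [Matrix.cons_val_zero, Matrix.cons_val_one]
    rfl
  refine hmaj.trans (le_of_eq ?_)
  -- the triple sum with two coordinates forced, then the difference variable runs over the product torus
  calc ∑ x : Fin 3 → SpaceTimeIdx L M, (if x 0 = y ∧ x 2 = x 1 then c * CS (D y (x 1)) else 0)
      = ∑ w : SpaceTimeIdx L M, c * CS (D y w) := sum_pairForced (fun w => c * CS (D y w)) y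
    _ = c * ∑ z : TorusSite 1 (2 * M) × TorusSite 2 L, CS z := by
        rw [← mul_sum]
        exact congrArg (c * ·) (sum_spaceTime_eq_sum_prodTorus (fun z => CS z) y)

/-! ### §3 Pair-transfer BUMPS: the scale-free bound -/

/-- **A pair-transfer bump has plain four-leg line `O(ε_x³·c·2M·L²·A)`**: under the majorant of `fixedTupleL1_le_of_pairTransfer` with a symbol
`G` that is a bump of rates `(s₀, s₁) ∈ (0,1]²` on `(ℤ/2M)¹ × (ℤ/L)²` (support `≤ n₀(s₀·2M)(s₁L)²`, sup `≤ A`, time/axis second differences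
`≤ A(4/(s₀·2M))²`, `≤ A(4/(s₁L))²`), `fixedTupleL1 L M β 3 B Ω y ≤ ε_x³·c·√(10485760·n₀)·(2M·L²)·A`. [cite: Katznelson2004, Ch. I §6.3] -/
theorem fixedTupleL1_le_of_pairTransfer_bump {N : ℕ} {β : ℝ} (hβ : 0 ≤ β) (B : (Fin 4 → SectorLeg N) → (Fin 4 → SpaceTimeIdx L M) → ℂ)
    (Ω : Fin 4 → SectorLeg N) (G : TorusSite 1 (2 * M) × TorusSite 2 L → ℂ) {c : ℝ} (hc : 0 ≤ c)
    (hB : ∀ x : Fin 4 → SpaceTimeIdx L M, ‖B Ω x‖ ≤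
      if x 1 = x 0 ∧ x 3 = x 2 then c * ‖∑ q : TorusSite 1 (2 * M) × TorusSite 2 L,
        (torusChar q.1 (fun _ : Fin 1 => (((x 0).1 : ℕ) : ZMod (2 * M)) - (((x 2).1 : ℕ) : ZMod (2 * M))) *
          torusChar q.2 ((x 0).2 - (x 2).2)) • G q‖ else 0)
    {s₀ s₁ : ℝ} (hs₀ : 0 < s₀) (hs₀1 : s₀ ≤ 1) (hs₁ : 0 < s₁) (hs₁1 : s₁ ≤ 1) {A : ℝ} (hA : 0 ≤ A) {Ns : ℕ} {n₀ : ℝ}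
    (hn₀ : 0 ≤ n₀) (hNs : (Ns : ℝ) ≤ n₀ * (s₀ * (2 * M : ℕ)) * (s₁ * L) ^ 2)
    (hsupp : (univ.filter fun q => G q ≠ 0).card ≤ Ns) (hsup : ∀ q, ‖G q‖ ≤ A)
    (h₀ : ∀ q, ‖(fwdDiff ((fun _ : Fin 1 => (1 : ZMod (2 * M))), (0 : TorusSite 2 L)))^[2] G q‖ ≤ A * (4 / (s₀ * (2 * M : ℕ))) ^ 2)
    (h₁ : ∀ q (i : Fin 2), ‖(fwdDiff ((0 : TorusSite 1 (2 * M)), (Pi.single i (1 : ZMod L) : TorusSite 2 L)))^[2] G q‖ ≤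
      A * (4 / (s₁ * L)) ^ 2) (y : SpaceTimeIdx L M) :
    fixedTupleL1 L M β 3 B Ω y ≤ imagTimeWeight β M ^ 3 * (c * (Real.sqrt (10485760 * n₀) * (((2 * M : ℕ) : ℝ) * (L : ℝ) ^ 2) * A)) := by
  refine (fixedTupleL1_le_of_pairTransfer hβ B Ω G hB y).trans ?_
  refine mul_le_mul_of_nonneg_left (mul_le_mul_of_nonneg_left ?_ hc) (pow_nonneg (imagTimeWeight_nonneg hβ M) 3)
  exact sum_norm_charSum_bump_le (P := 2 * M) G hs₀ hs₀1 hs₁ hs₁1 hA hn₀ hNs hsupp hsup h₀ h₁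

/-! ### §4 The assembled bound and the import-row shape -/

/-- **The plain four-leg line of a superposition of pair-transfer bumps is paid by the `ℓ¹` sum of the amplitudes**: if
`W Ω x = Σ_{i∈S} a_i·B_i Ω x + R Ω x` with every `B_i` majorised by a pair-transfer form of a bump `G_i` (rates `(s₀ⁱ,s₁ⁱ) ∈ (0,1]²`, size `A_i`,
support `≤ n₀(s₀ⁱ·2M)(s₁ⁱL)²`, common normalisation `c`), then
`fixedTupleL1(W) Ω y ≤ ε_x³·c·√(10485760·n₀)·(2M·L²)·Σ_i ‖a_i‖·A_i + fixedTupleL1(R) Ω y`. [cite: Katznelson2004, Ch. I §6.3] -/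
theorem fixedTupleL1_le_of_pairTransfer_superposition {ι : Type*} {N : ℕ} {β : ℝ} (hβ : 0 ≤ β) (S : Finset ι) (a : ι → ℂ)
    (W R : (Fin 4 → SectorLeg N) → (Fin 4 → SpaceTimeIdx L M) → ℂ) (B : ι → (Fin 4 → SectorLeg N) → (Fin 4 → SpaceTimeIdx L M) → ℂ)
    (Ω : Fin 4 → SectorLeg N) (hW : ∀ x, W Ω x = ∑ i ∈ S, a i * B i Ω x + R Ω x)
    (G : ι → TorusSite 1 (2 * M) × TorusSite 2 L → ℂ) {c : ℝ} (hc : 0 ≤ c)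
    (hB : ∀ i ∈ S, ∀ x : Fin 4 → SpaceTimeIdx L M, ‖B i Ω x‖ ≤
      if x 1 = x 0 ∧ x 3 = x 2 then c * ‖∑ q : TorusSite 1 (2 * M) × TorusSite 2 L,
        (torusChar q.1 (fun _ : Fin 1 => (((x 0).1 : ℕ) : ZMod (2 * M)) - (((x 2).1 : ℕ) : ZMod (2 * M))) *
          torusChar q.2 ((x 0).2 - (x 2).2)) • G i q‖ else 0)
    (s₀ s₁ A : ι → ℝ) (Ns : ι → ℕ) {n₀ : ℝ} (hn₀ : 0 ≤ n₀)
    (hs₀ : ∀ i ∈ S, 0 < s₀ i) (hs₀1 : ∀ i ∈ S, s₀ i ≤ 1) (hs₁ : ∀ i ∈ S, 0 < s₁ i) (hs₁1 : ∀ i ∈ S, s₁ i ≤ 1)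
    (hA : ∀ i ∈ S, 0 ≤ A i) (hNs : ∀ i ∈ S, (Ns i : ℝ) ≤ n₀ * (s₀ i * (2 * M : ℕ)) * (s₁ i * L) ^ 2)
    (hsupp : ∀ i ∈ S, (univ.filter fun q => G i q ≠ 0).card ≤ Ns i) (hsup : ∀ i ∈ S, ∀ q, ‖G i q‖ ≤ A i)
    (h₀ : ∀ i ∈ S, ∀ q, ‖(fwdDiff ((fun _ : Fin 1 => (1 : ZMod (2 * M))), (0 : TorusSite 2 L)))^[2] (G i) q‖ ≤
      A i * (4 / (s₀ i * (2 * M : ℕ))) ^ 2)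
    (h₁ : ∀ i ∈ S, ∀ q (j : Fin 2), ‖(fwdDiff ((0 : TorusSite 1 (2 * M)), (Pi.single j (1 : ZMod L) : TorusSite 2 L)))^[2] (G i) q‖ ≤
      A i * (4 / (s₁ i * L)) ^ 2) (y : SpaceTimeIdx L M) :
    fixedTupleL1 L M β 3 W Ω y ≤ imagTimeWeight β M ^ 3 * (c * (Real.sqrt (10485760 * n₀) * (((2 * M : ℕ) : ℝ) * (L : ℝ) ^ 2))) *
        ∑ i ∈ S, ‖a i‖ * A i + fixedTupleL1 L M β 3 R Ω y := by
  refine (fixedTupleL1_le_of_superposition hβ S a W R B Ω hW y).trans (add_le_add ?_ le_rfl)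
  rw [mul_sum]
  refine sum_le_sum fun i hi => ?_
  have hb := fixedTupleL1_le_of_pairTransfer_bump hβ (B i) Ω (G i) hc (hB i hi) (hs₀ i hi) (hs₀1 i hi) (hs₁ i hi) (hs₁1 i hi)
    (hA i hi) hn₀ (hNs i hi) (hsupp i hi) (hsup i hi) (h₀ i hi) (h₁ i hi) y
  calc ‖a i‖ * fixedTupleL1 L M β 3 (B i) Ω y
      ≤ ‖a i‖ * (imagTimeWeight β M ^ 3 * (c * (Real.sqrt (10485760 * n₀) * (((2 * M : ℕ) : ℝ) * (L : ℝ) ^ 2) * A i))) :=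
        mul_le_mul_of_nonneg_left hb (norm_nonneg _)
    _ = _ := by ring

/-- **The import-row shape** («plain four-leg line from a pair-transfer dyadic representation + a total-variation law»): let `𝒱` be any
Grassmann element whose quartic position kernel is, for EVERY label tuple `((0,s),c')`, a superposition `Σ_{i∈S} a_i·B_i + R` of pair-transfer
bumps as in `fixedTupleL1_le_of_pairTransfer_superposition` (amplitudes `a`, sizes `A`, remainder of plain line `≤ r`), with
`Σ_{i∈S} ‖a_i‖·A_i ≤ V` and `ε_x³·c·(2M·L²) ≤ κ`.  Then the plain four-leg pinned line obeys
`fixedTupleL1 L M β 3 (sectorisedKernel … trivialMultiplier 𝒱 4) ((0,s),c') y₀ ≤ κ·√(10485760·n₀)·V + r` for all `s, c', y₀` — the hypothesis shape of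
`EngineV8.importRowsF_of_plainLines_klEng` with `s₄·lam := κ·√(10485760·n₀)·V + r`.  (With `S = range n` and `a_i` the scale increments of the
quartic values at the pinned momenta, child 1's row 7 gives `V = (11/9)U + C·U²`: `U`-currency, uniformly in `n`.) [cite: BenfattoGiulianiMastropietro2006, §3 (3.65)] -/
theorem plainFourLegLine_of_pairTransfer_superposition {ι : Type*} {β : ℝ} (hβ : 0 ≤ β) (𝒱 : HubbardGrassmann L M)
    (S : Finset ι) (a : (Fin 4 → Fin 2) → (Fin 4 → Fin 2) → ι → ℂ)
    (B : (Fin 4 → Fin 2) → (Fin 4 → Fin 2) → ι → (Fin 4 → SectorLeg 1) → (Fin 4 → SpaceTimeIdx L M) → ℂ)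
    (R : (Fin 4 → Fin 2) → (Fin 4 → Fin 2) → (Fin 4 → SectorLeg 1) → (Fin 4 → SpaceTimeIdx L M) → ℂ)
    (G : (Fin 4 → Fin 2) → (Fin 4 → Fin 2) → ι → TorusSite 1 (2 * M) × TorusSite 2 L → ℂ) {c : ℝ} (hc : 0 ≤ c)
    (s₀ s₁ A : (Fin 4 → Fin 2) → (Fin 4 → Fin 2) → ι → ℝ) (Ns : (Fin 4 → Fin 2) → (Fin 4 → Fin 2) → ι → ℕ)
    {n₀ V r κ : ℝ} (hn₀ : 0 ≤ n₀)
    (hW : ∀ (s c' : Fin 4 → Fin 2) (x : Fin 4 → SpaceTimeIdx L M),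
      sectorisedKernel L M β (trivialMultiplier L M) 𝒱 4 (fun i => (((0 : Fin 1), s i), c' i)) x =
        ∑ i ∈ S, a s c' i * B s c' i (fun i => (((0 : Fin 1), s i), c' i)) x + R s c' (fun i => (((0 : Fin 1), s i), c' i)) x)
    (hB : ∀ (s c' : Fin 4 → Fin 2), ∀ i ∈ S, ∀ x : Fin 4 → SpaceTimeIdx L M, ‖B s c' i (fun i => (((0 : Fin 1), s i), c' i)) x‖ ≤
      if x 1 = x 0 ∧ x 3 = x 2 then c * ‖∑ q : TorusSite 1 (2 * M) × TorusSite 2 L,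
        (torusChar q.1 (fun _ : Fin 1 => (((x 0).1 : ℕ) : ZMod (2 * M)) - (((x 2).1 : ℕ) : ZMod (2 * M))) *
          torusChar q.2 ((x 0).2 - (x 2).2)) • G s c' i q‖ else 0)
    (hs₀ : ∀ s c', ∀ i ∈ S, 0 < s₀ s c' i) (hs₀1 : ∀ s c', ∀ i ∈ S, s₀ s c' i ≤ 1)
    (hs₁ : ∀ s c', ∀ i ∈ S, 0 < s₁ s c' i) (hs₁1 : ∀ s c', ∀ i ∈ S, s₁ s c' i ≤ 1) (hA : ∀ s c', ∀ i ∈ S, 0 ≤ A s c' i)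
    (hNs : ∀ s c', ∀ i ∈ S, (Ns s c' i : ℝ) ≤ n₀ * (s₀ s c' i * (2 * M : ℕ)) * (s₁ s c' i * L) ^ 2)
    (hsupp : ∀ s c', ∀ i ∈ S, (univ.filter fun q => G s c' i q ≠ 0).card ≤ Ns s c' i)
    (hsup : ∀ s c', ∀ i ∈ S, ∀ q, ‖G s c' i q‖ ≤ A s c' i)
    (h₀ : ∀ s c', ∀ i ∈ S, ∀ q, ‖(fwdDiff ((fun _ : Fin 1 => (1 : ZMod (2 * M))), (0 : TorusSite 2 L)))^[2] (G s c' i) q‖ ≤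
      A s c' i * (4 / (s₀ s c' i * (2 * M : ℕ))) ^ 2)
    (h₁ : ∀ s c', ∀ i ∈ S, ∀ q (j : Fin 2),
      ‖(fwdDiff ((0 : TorusSite 1 (2 * M)), (Pi.single j (1 : ZMod L) : TorusSite 2 L)))^[2] (G s c' i) q‖ ≤ A s c' i * (4 / (s₁ s c' i * L)) ^ 2)
    (hV : ∀ s c', ∑ i ∈ S, ‖a s c' i‖ * A s c' i ≤ V)
    (hr : ∀ (s c' : Fin 4 → Fin 2) (y₀ : SpaceTimeIdx L M), fixedTupleL1 L M β 3 (R s c') (fun i => (((0 : Fin 1), s i), c' i)) y₀ ≤ r)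
    (hκ : imagTimeWeight β M ^ 3 * (c * (((2 * M : ℕ) : ℝ) * (L : ℝ) ^ 2)) ≤ κ) :
    ∀ (s c' : Fin 4 → Fin 2) (y₀ : SpaceTimeIdx L M),
      fixedTupleL1 L M β 3 (sectorisedKernel L M β (trivialMultiplier L M) 𝒱 4) (fun i => (((0 : Fin 1), s i), c' i)) y₀ ≤
        κ * Real.sqrt (10485760 * n₀) * V + r := by
  intro s c' y₀
  have h := fixedTupleL1_le_of_pairTransfer_superposition hβ S (a s c') (sectorisedKernel L M β (trivialMultiplier L M) 𝒱 4) (R s c')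
    (B s c') (fun i => (((0 : Fin 1), s i), c' i)) (hW s c') (G s c') hc (hB s c') (s₀ s c') (s₁ s c') (A s c') (Ns s c') hn₀
    (hs₀ s c') (hs₀1 s c') (hs₁ s c') (hs₁1 s c') (hA s c') (hNs s c') (hsupp s c') (hsup s c') (h₀ s c') (h₁ s c') y₀
  refine h.trans (add_le_add ?_ (hr s c' y₀))
  have hsq : 0 ≤ Real.sqrt (10485760 * n₀) := Real.sqrt_nonneg _
  have hVs : 0 ≤ ∑ i ∈ S, ‖a s c' i‖ * A s c' i := sum_nonneg fun i hi => mul_nonneg (norm_nonneg _) (hA s c' i hi)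
  have hε : 0 ≤ imagTimeWeight β M ^ 3 * (c * (((2 * M : ℕ) : ℝ) * (L : ℝ) ^ 2)) := by
    have := imagTimeWeight_nonneg hβ M; positivity
  calc imagTimeWeight β M ^ 3 * (c * (Real.sqrt (10485760 * n₀) * (((2 * M : ℕ) : ℝ) * (L : ℝ) ^ 2))) * ∑ i ∈ S, ‖a s c' i‖ * A s c' i
      = (imagTimeWeight β M ^ 3 * (c * (((2 * M : ℕ) : ℝ) * (L : ℝ) ^ 2))) * Real.sqrt (10485760 * n₀) *
          ∑ i ∈ S, ‖a s c' i‖ * A s c' i := by ring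
    _ ≤ κ * Real.sqrt (10485760 * n₀) * V :=
        mul_le_mul (mul_le_mul_of_nonneg_right hκ hsq) (hV s c') hVs (mul_nonneg (hε.trans hκ) hsq)

end Summit.HubbardSuperconductivity.HubbardSuperconductivity.Theorems.TorusFourierL2

end
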